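import Mathlib.Analysis.Convex.Slope
import Mathlib.Analysis.Calculus.Deriv.MeanValue
import Mathlib.Analysis.SpecialFunctions.Sqrt
import Summits.HubbardSuperconductivity.HubbardSuperconductivity.Theorems.ThermalWedgeTwSourcedCondensationEngineSusceptibility
import Summits.HubbardSuperconductivity.HubbardSuperconductivity.Theorems.ThermalWedgeTwSeededEnsembleEquivalenceRUniqOfStrictConcavity

/-!
# Crux `TwSeededEnsembleEquivalenceR` (stmt-HubbardSuperconductivity-15581), line `cold-floor-collapse`
# (slug `Sketch`) — UNIQ′ FROM PAIRING SATURATION (the Gibbs-state form of the physics input)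

Support file (`--supports stmt-HubbardSuperconductivity-15581`; sorry-free; no definition).

`…RUniqOfStrictConcavity` reduced the physics stub UNIQ′ (`stub_sourcedColdUniq`) to SCONC, strict concavity of
the cold sourced LIMIT pressure in the squared source `s = h²`. Here SCONC is reduced to a statement about ONE
correlation function of the finite-volume cold sourced Gibbs state, uniform in `L`: with `Q = Δ_d + Δ_dᴴ` the pair
source and `D_L(s) := Re⟨Q⟩_{β,L,U,μ,√s}/(2√s·L²)` — half the CHORD pair susceptibility (induced pair amplitude per
site divided by the source), which is exactly the `s`-derivative of `s ↦ p̃_L(μ,√s)` —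

  SAT:  `c·(s' − s) ≤ D_L(s) − D_L(s')`  for `0 < s < s' < (13g+1)²`, some `c > 0`, all large `L`

(PAIRING SATURATION: the chord pair susceptibility strictly decreases with the squared source at a rate uniform in
the volume — no metamagnetic-type upturn of the pair response, i.e. no first-order jump of the optimal source; at
`U = 0` it is the strict decrease of `E ↦ tanh(βE/2)/E`).

* `ups_slope_gap_of_deriv_gap` (pure real analysis): if `ψ` is continuous on `[x,z]`, differentiable on `(x,z)` and
  `ψ'(u) − ψ'(v) ≥ c (v − u)` for `x < u < v < z`, then for `x < y < z` the adjacent secant slopes satisfy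
  `slope(x,y) − slope(y,z) ≥ c (z − x)/2` (two monotonicity arguments).
* `ups_hasDerivAt_sourcedPressure_sq` — `d/ds p̃_L(μ,√s) = D_L(s)` for `s > 0`
  (`hasDerivAt_log_partitionFn_source` ∘ `√`).
* `ups_strictConcavity_of_pairingSaturation` — **SAT ⟹ SCONC** (hypothesis of
  `usc_stub_sourcedColdUniq_of_strictConcavity`, verbatim): the finite-volume slope gaps pass to every pointwise
  thermodynamic limit and give `StrictConcaveOn ℝ [0,(13g+1)²] (s ↦ q μ √s)` by
  `strictConcaveOn_of_slope_strict_anti_adjacent`.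
* `ups_stub_sourcedColdUniq_of_pairingSaturation` — **SAT ⟹ UNIQ′** (registered signature of `stub_sourcedColdUniq`
  verbatim).

[folklore composition]
-/

set_option linter.dupNamespace false

namespace Summit.HubbardSuperconductivity.HubbardSuperconductivity.Theorems

open Matrix Set Literature.MathematicalPhysics.QuantumLattice
open Summit.HubbardSuperconductivity.HubbardSuperconductivity.Theorems.TwSeededEnsembleEquivalenceR.ColdFloorLine
open scoped ComplexOrder

noncomputable section

/-! ### Pure real analysis: a uniform derivative gap gives a uniform adjacent-slope gap -/

/-- **Adjacent secant slopes from a derivative gap.** If `ψ` is continuous on `[x, z]`, has derivative `ψ' u`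
at every `u ∈ (x, z)`, and `c (v − u) ≤ ψ' u − ψ' v` whenever `x < u < v < z`, then for `x < y < z`
`c (z − x)/2 ≤ (ψ y − ψ x)/(y − x) − (ψ z − ψ y)/(z − y)`. [folklore] -/
theorem ups_slope_gap_of_deriv_gap {ψ ψ' : ℝ → ℝ} {x y z c : ℝ} (hxy : x < y) (hyz : y < z)
    (hcont : ContinuousOn ψ (Set.Icc x z)) (hder : ∀ u ∈ Set.Ioo x z, HasDerivAt ψ (ψ' u) u)
    (hsat : ∀ u v : ℝ, x < u → u < v → v < z → c * (v - u) ≤ ψ' u - ψ' v) :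
    c * (z - x) / 2 ≤ (ψ y - ψ x) / (y - x) - (ψ z - ψ y) / (z - y) := by
  -- left piece: `ψ y − ψ x ≥ (y − x) ψ' y + c (y − x)²/2`
  have hleft : (y - x) * ψ' y + c * (y - x) ^ 2 / 2 ≤ ψ y - ψ x := by
    set Φ : ℝ → ℝ := fun u => ψ y - ψ u - (y - u) * ψ' y - c * ((y - u) * (y - u)) / 2 with hΦ_def
    have hΦder : ∀ u ∈ Set.Ioo x y, HasDerivAt Φ (-ψ' u + ψ' y + c * (y - u)) u := by
      intro u hu
      have h1 := hder u ⟨hu.1, hu.2.trans hyz⟩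
      have h2 : HasDerivAt (fun u : ℝ => y - u) (-1) u := by
        simpa using (hasDerivAt_id u).const_sub y
      have h3 : HasDerivAt (fun u : ℝ => (y - u) * (y - u)) ((-1) * (y - u) + (y - u) * (-1)) u :=
        h2.mul h2
      have h4 := ((((hasDerivAt_const u (ψ y)).sub h1).sub (h2.mul_const (ψ' y))).sub
        ((h3.const_mul c).div_const 2))
      refine h4.congr_deriv ?_
      ring
    have hΦcont : ContinuousOn Φ (Set.Icc x y) := by
      have hψ : ContinuousOn ψ (Set.Icc x y) := hcont.mono (Set.Icc_subset_Icc_right hyz.le)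
      simp only [hΦ_def]
      fun_prop
    have hΦdiff : DifferentiableOn ℝ Φ (interior (Set.Icc x y)) := by
      rw [interior_Icc]; exact fun u hu => (hΦder u hu).differentiableAt.differentiableWithinAt
    have hΦanti : AntitoneOn Φ (Set.Icc x y) := by
      refine antitoneOn_of_deriv_nonpos (convex_Icc x y) hΦcont hΦdiff fun u hu => ?_
      rw [interior_Icc] at hu
      rw [(hΦder u hu).deriv]
      have := hsat u y hu.1 hu.2 hyz
      linarith
    have key := hΦanti ⟨le_rfl, hxy.le⟩ ⟨hxy.le, le_rfl⟩ hxy.le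
    -- key : Φ y ≤ Φ x
    simp only [hΦ_def, sub_self, zero_mul, mul_zero, zero_div] at key
    have e : c * (y - x) ^ 2 / 2 = c * ((y - x) * (y - x)) / 2 := by ring
    linarith [key]
  -- right piece: `ψ z − ψ y ≤ (z − y) ψ' y − c (z − y)²/2`
  have hright : ψ z - ψ y ≤ (z - y) * ψ' y - c * (z - y) ^ 2 / 2 := by
    set Θ : ℝ → ℝ := fun v => ψ v - ψ y - (v - y) * ψ' y + c * ((v - y) * (v - y)) / 2 with hΘ_def
    have hΘder : ∀ v ∈ Set.Ioo y z, HasDerivAt Θ (ψ' v - ψ' y + c * (v - y)) v := by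
      intro v hv
      have h1 := hder v ⟨hxy.trans hv.1, hv.2⟩
      have h2 : HasDerivAt (fun v : ℝ => v - y) 1 v := by
        simpa using (hasDerivAt_id v).sub_const y
      have h3 : HasDerivAt (fun v : ℝ => (v - y) * (v - y)) (1 * (v - y) + (v - y) * 1) v :=
        h2.mul h2
      have h4 := (((h1.sub (hasDerivAt_const v (ψ y))).sub (h2.mul_const (ψ' y))).add
        ((h3.const_mul c).div_const 2))
      refine h4.congr_deriv ?_
      ring
    have hΘcont : ContinuousOn Θ (Set.Icc y z) := by
      have hψ : ContinuousOn ψ (Set.Icc y z) := hcont.mono (Set.Icc_subset_Icc_left hxy.le)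
      simp only [hΘ_def]
      fun_prop
    have hΘdiff : DifferentiableOn ℝ Θ (interior (Set.Icc y z)) := by
      rw [interior_Icc]; exact fun v hv => (hΘder v hv).differentiableAt.differentiableWithinAt
    have hΘanti : AntitoneOn Θ (Set.Icc y z) := by
      refine antitoneOn_of_deriv_nonpos (convex_Icc y z) hΘcont hΘdiff fun v hv => ?_
      rw [interior_Icc] at hv
      rw [(hΘder v hv).deriv]
      have := hsat y v hxy hv.1 hv.2
      linarith
    have key := hΘanti ⟨le_rfl, hyz.le⟩ ⟨hyz.le, le_rfl⟩ hyz.le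
    simp only [hΘ_def, sub_self, zero_mul, mul_zero, zero_div, add_zero] at key
    have e : c * (z - y) ^ 2 / 2 = c * ((z - y) * (z - y)) / 2 := by ring
    linarith [key]
  have hyx : 0 < y - x := by linarith
  have hzy : 0 < z - y := by linarith
  have e1 : ψ' y + c * (y - x) / 2 ≤ (ψ y - ψ x) / (y - x) := by
    rw [le_div_iff₀ hyx]
    have : (ψ' y + c * (y - x) / 2) * (y - x) = (y - x) * ψ' y + c * (y - x) ^ 2 / 2 := by ring
    linarith
  have e2 : (ψ z - ψ y) / (z - y) ≤ ψ' y - c * (z - y) / 2 := by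
    rw [div_le_iff₀ hzy]
    have : (ψ' y - c * (z - y) / 2) * (z - y) = (z - y) * ψ' y - c * (z - y) ^ 2 / 2 := by ring
    linarith
  have e3 : c * (z - x) / 2 = c * (y - x) / 2 + c * (z - y) / 2 := by ring
  linarith

/-- Three-term linear combinations of limits inherit eventual lower bounds: if `uₙ → A`, `vₙ → B`,
`wₙ → C` (`ε`–`N` form) and `γ ≤ α uₙ + β vₙ + δ wₙ` eventually, then `γ ≤ α A + β B + δ C`. [folklore] -/
theorem ups_lin3_ge_of_limits {u v w : ℕ → ℝ} {A B C α β δ γ : ℝ}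
    (hu : ∀ κ : ℝ, 0 < κ → ∃ N : ℕ, ∀ n, N ≤ n → |u n - A| ≤ κ)
    (hv : ∀ κ : ℝ, 0 < κ → ∃ N : ℕ, ∀ n, N ≤ n → |v n - B| ≤ κ)
    (hw : ∀ κ : ℝ, 0 < κ → ∃ N : ℕ, ∀ n, N ≤ n → |w n - C| ≤ κ)
    (h : ∃ N₀ : ℕ, ∀ n, N₀ ≤ n → γ ≤ α * u n + β * v n + δ * w n) :
    γ ≤ α * A + β * B + δ * C := by
  apply le_of_forall_pos_lt_add
  intro ε hε
  have hM : 0 < |α| + |β| + |δ| + 1 := by positivity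
  obtain ⟨N₁, hN₁⟩ := hu (ε / (2 * (|α| + |β| + |δ| + 1))) (by positivity)
  obtain ⟨N₂, hN₂⟩ := hv (ε / (2 * (|α| + |β| + |δ| + 1))) (by positivity)
  obtain ⟨N₃, hN₃⟩ := hw (ε / (2 * (|α| + |β| + |δ| + 1))) (by positivity)
  obtain ⟨N₀, hN₀⟩ := h
  set n := max N₀ (max N₁ (max N₂ N₃)) with hn
  have h0 := hN₀ n (le_max_left _ _)
  have h1 := hN₁ n ((le_max_left _ _).trans (le_max_right _ _))
  have h2 := hN₂ n (((le_max_left _ _).trans (le_max_right _ _)).trans (le_max_right _ _))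
  have h3 := hN₃ n (((le_max_right _ _).trans (le_max_right _ _)).trans (le_max_right _ _))
  set κ := ε / (2 * (|α| + |β| + |δ| + 1)) with hκ
  have hκpos : 0 < κ := by positivity
  have hb1 : |α * (u n - A)| ≤ |α| * κ := by rw [abs_mul]; exact mul_le_mul_of_nonneg_left h1 (abs_nonneg _)
  have hb2 : |β * (v n - B)| ≤ |β| * κ := by rw [abs_mul]; exact mul_le_mul_of_nonneg_left h2 (abs_nonneg _)
  have hb3 : |δ * (w n - C)| ≤ |δ| * κ := by rw [abs_mul]; exact mul_le_mul_of_nonneg_left h3 (abs_nonneg _)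
  have hsumκ : (|α| + |β| + |δ|) * κ < ε := by
    rw [hκ, ← mul_div_assoc, div_lt_iff₀ (by positivity)]
    nlinarith [abs_nonneg α, abs_nonneg β, abs_nonneg δ]
  have l1 := (abs_le.mp hb1).2
  have l2 := (abs_le.mp hb2).2
  have l3 := (abs_le.mp hb3).2
  have r1 : α * (u n - A) = α * u n - α * A := by ring
  have r2 : β * (v n - B) = β * v n - β * B := by ring
  have r3 : δ * (w n - C) = δ * w n - δ * C := by ring
  have r4 : (|α| + |β| + |δ|) * κ = |α| * κ + |β| * κ + |δ| * κ := by ring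
  linarith

/-! ### The finite-volume sourced pressure in the squared source -/

/-- **`d/ds p̃_L(μ, √s) = Re⟨Q⟩_{√s}/(2√s L²)` for `s > 0`** (`Q = Δ_d + Δ_dᴴ`, `β > 0`): the chain rule on
`d/dh log Z(H_L(μ) − hQ) = β Re⟨Q⟩_h` (`hasDerivAt_log_partitionFn_source`). [folklore] -/
theorem ups_hasDerivAt_sourcedPressure_sq (L : ℕ) [NeZero L] (U μ : ℝ) {β : ℝ} (hβ : 0 < β) {s : ℝ}
    (hs : 0 < s) :
    HasDerivAt (fun s' : ℝ =>
        Real.log (partitionFn β (dWaveSourceTorus L U μ (Real.sqrt s'))).re / (β * (L : ℝ) ^ 2))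
      ((gibbsState β (dWaveSourceTorus L U μ (Real.sqrt s))
          (pairField dWaveFormFactor L + (pairField dWaveFormFactor L)ᴴ)).re /
        (2 * Real.sqrt s * (L : ℝ) ^ 2)) s := by
  have hL := cast_sq_pos_of_neZero L
  have hβL : 0 < β * (L : ℝ) ^ 2 := mul_pos hβ hL
  have h1 := hasDerivAt_log_partitionFn_source (isHermitian_hubbardTorusWith L 1 U μ)
    (isHermitian_pairField_add_conjTranspose L) hβ (Real.sqrt s)
  have h2 : HasDerivAt Real.sqrt (1 / (2 * Real.sqrt s)) s := Real.hasDerivAt_sqrt hs.ne'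
  have h3 := (h1.comp s h2).div_const (β * (L : ℝ) ^ 2)
  have hfun : (fun s' : ℝ =>
      Real.log (partitionFn β (dWaveSourceTorus L U μ (Real.sqrt s'))).re / (β * (L : ℝ) ^ 2)) =
      fun s' => ((fun t : ℝ => Real.log (partitionFn β (hubbardTorusWith 2 L 1 U μ -
        (t : ℂ) • (pairField dWaveFormFactor L + (pairField dWaveFormFactor L)ᴴ))).re) ∘ Real.sqrt) s' /
          (β * (L : ℝ) ^ 2) := by
    funext s'; rfl
  rw [hfun]
  refine h3.congr_deriv ?_
  have hsq : 0 < Real.sqrt s := Real.sqrt_pos.mpr hs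
  show β * (gibbsState β (dWaveSourceTorus L U μ (Real.sqrt s))
      (pairField dWaveFormFactor L + (pairField dWaveFormFactor L)ᴴ)).re * (1 / (2 * Real.sqrt s)) /
      (β * (L : ℝ) ^ 2) = _
  field_simp

/-- The finite-volume sourced pressure is continuous in the source (it is differentiable). [folklore] -/
theorem ups_continuous_sourcedPressure (L : ℕ) [NeZero L] (U μ : ℝ) {β : ℝ} (hβ : 0 < β) :
    Continuous (fun h : ℝ => Real.log (partitionFn β (dWaveSourceTorus L U μ h)).re / (β * (L : ℝ) ^ 2)) := by
  have hd : ∀ h : ℝ, HasDerivAt (fun t : ℝ => Real.log (partitionFn β (dWaveSourceTorus L U μ t)).re)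
      (β * (gibbsState β (dWaveSourceTorus L U μ h)
        (pairField dWaveFormFactor L + (pairField dWaveFormFactor L)ᴴ)).re) h := fun h =>
    hasDerivAt_log_partitionFn_source (isHermitian_hubbardTorusWith L 1 U μ)
      (isHermitian_pairField_add_conjTranspose L) hβ h
  have hc : Continuous (fun t : ℝ => Real.log (partitionFn β (dWaveSourceTorus L U μ t)).re) :=
    continuous_iff_continuousAt.mpr fun h => (hd h).continuousAt
  exact hc.div_const _

/-! ### SAT ⟹ SCONC ⟹ UNIQ′ -/

/-- **Pairing saturation gives strict `s`-concavity of the cold sourced limit pressure (SAT ⟹ SCONC).** With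
`D_L(s) = Re⟨Δ_d + Δ_dᴴ⟩_{β,L,U,μ,√s}/(2√s L²)` (the `s`-derivative of `s ↦ p̃_L(μ,√s)`, half the chord pair
susceptibility): if `c (s' − s) ≤ D_L(s) − D_L(s')` for `0 < s < s' < (13g+1)²` with `c > 0` uniformly in
large `L`, then every pointwise thermodynamic limit `q` of the sourced pressure has
`StrictConcaveOn ℝ [0,(13g+1)²] (s ↦ q μ √s)` — the hypothesis of `usc_stub_sourcedColdUniq_of_strictConcavity`,
verbatim. [folklore composition] -/
theorem ups_strictConcavity_of_pairingSaturation :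
    (∀ (μ₁ μ₂ : ℝ), -4 < μ₁ → μ₁ < μ₂ → μ₂ < 0 → ∃ a₁ : ℝ, 0 < a₁ ∧ ∀ a ∈ Set.Ioc (0 : ℝ) a₁,
      ∃ K' U₀ : ℝ, 0 < K' ∧ 0 < U₀ ∧ ∀ U ∈ Set.Ioc (0 : ℝ) U₀, ∀ g ∈ Set.Icc (K' * U) (1 / 10),
        ∀ μ ∈ Set.Ioo μ₁ μ₂, ∃ c : ℝ, 0 < c ∧ ∃ L₀ : ℕ, ∀ (L : ℕ) [NeZero L], L₀ ≤ L →
          ∀ s s' : ℝ, 0 < s → s < s' → s' < (13 * g + 1) ^ 2 →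
            c * (s' - s) ≤
              (Matrix.gibbsState (Real.exp (a / U)) (dWaveSourceTorus L U μ (Real.sqrt s))
                    (pairField dWaveFormFactor L + (pairField dWaveFormFactor L)ᴴ)).re /
                  (2 * Real.sqrt s * (L : ℝ) ^ 2) -
                (Matrix.gibbsState (Real.exp (a / U)) (dWaveSourceTorus L U μ (Real.sqrt s'))
                    (pairField dWaveFormFactor L + (pairField dWaveFormFactor L)ᴴ)).re /
                  (2 * Real.sqrt s' * (L : ℝ) ^ 2)) →
    ∀ (μ₁ μ₂ : ℝ), -4 < μ₁ → μ₁ < μ₂ → μ₂ < 0 → ∃ a₁ : ℝ, 0 < a₁ ∧ ∀ a ∈ Set.Ioc (0 : ℝ) a₁,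
      ∃ K' U₀ : ℝ, 0 < K' ∧ 0 < U₀ ∧ ∀ U ∈ Set.Ioc (0 : ℝ) U₀, ∀ g ∈ Set.Icc (K' * U) (1 / 10),
        ∀ q : ℝ → ℝ → ℝ,
          (∀ μ ∈ Set.Icc μ₁ μ₂, ∀ h ∈ Set.Icc (-(13 * g + 1)) (13 * g + 1), ∀ κ : ℝ, 0 < κ →
            ∃ L₀ : ℕ, ∀ (L : ℕ) [NeZero L], L₀ ≤ L →
              |Real.log (Matrix.partitionFn (Real.exp (a / U)) (dWaveSourceTorus L U μ h)).re /
                  (Real.exp (a / U) * (L : ℝ) ^ 2) - q μ h| ≤ κ) →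
          ∀ μ ∈ Set.Ioo μ₁ μ₂,
            StrictConcaveOn ℝ (Set.Icc (0 : ℝ) ((13 * g + 1) ^ 2)) (fun s : ℝ => q μ (Real.sqrt s)) := by
  intro hS μ₁ μ₂ h4 h12 h0
  obtain ⟨a₁, ha₁, hA⟩ := hS μ₁ μ₂ h4 h12 h0
  refine ⟨a₁, ha₁, fun a ha => ?_⟩
  obtain ⟨K', U₀, hK', hU₀, hB⟩ := hA a ha
  refine ⟨K', U₀, hK', hU₀, fun U hU g hg q hq μ hμ => ?_⟩
  obtain ⟨c, hc, L₀, hL₀⟩ := hB U hU g hg μ hμ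
  set R : ℝ := 13 * g + 1 with hR_def
  have hg0 : 0 < g := lt_of_lt_of_le (mul_pos hK' hU.1) hg.1
  have hR : 0 < R := by rw [hR_def]; positivity
  set β : ℝ := Real.exp (a / U) with hβ_def
  have hβ : 0 < β := Real.exp_pos _
  have hμ' : μ ∈ Set.Icc μ₁ μ₂ := ⟨hμ.1.le, hμ.2.le⟩
  -- finite-volume pressures in the squared source, side `n + 1`
  set ψ : ℕ → ℝ → ℝ := fun n s =>
    Real.log (partitionFn β (dWaveSourceTorus (n + 1) U μ (Real.sqrt s))).re / (β * ((n + 1 : ℕ) : ℝ) ^ 2)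
    with hψ_def
  -- pointwise limits on `[0, R²]`
  have hsqrt_mem : ∀ w ∈ Set.Icc (0 : ℝ) (R ^ 2), Real.sqrt w ∈ Set.Icc (-R) R := by
    intro w hw
    refine ⟨by linarith [Real.sqrt_nonneg w], ?_⟩
    rw [← Real.sqrt_sq hR.le]
    exact Real.sqrt_le_sqrt hw.2
  have hlim : ∀ w ∈ Set.Icc (0 : ℝ) (R ^ 2), ∀ κ : ℝ, 0 < κ → ∃ N : ℕ, ∀ n, N ≤ n →
      |ψ n w - q μ (Real.sqrt w)| ≤ κ := by
    intro w hw κ hκ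
    obtain ⟨L₁, hL₁⟩ := hq μ hμ' (Real.sqrt w) (hsqrt_mem w hw) κ hκ
    exact ⟨L₁, fun n hn => hL₁ (n + 1) (by omega)⟩
  -- finite-volume slope gaps
  have hgap : ∀ n : ℕ, L₀ ≤ n + 1 → ∀ x y z : ℝ, 0 ≤ x → x < y → y < z → z ≤ R ^ 2 →
      c * (z - x) / 2 ≤ (ψ n y - ψ n x) / (y - x) - (ψ n z - ψ n y) / (z - y) := by
    intro n hn x y z hx hxy hyz hz
    set D : ℝ → ℝ := fun s => (gibbsState β (dWaveSourceTorus (n + 1) U μ (Real.sqrt s))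
        (pairField dWaveFormFactor (n + 1) + (pairField dWaveFormFactor (n + 1))ᴴ)).re /
          (2 * Real.sqrt s * (((n + 1 : ℕ) : ℝ)) ^ 2) with hD_def
    have hder : ∀ u ∈ Set.Ioo x z, HasDerivAt (ψ n) (D u) u := by
      intro u hu
      have hu0 : 0 < u := lt_of_le_of_lt hx hu.1
      exact ups_hasDerivAt_sourcedPressure_sq (n + 1) U μ hβ hu0
    have hcont : ContinuousOn (ψ n) (Set.Icc x z) := by
      have hc := (ups_continuous_sourcedPressure (n + 1) U μ hβ).comp Real.continuous_sqrt
      exact hc.continuousOn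
    have hsat : ∀ u v : ℝ, x < u → u < v → v < z → c * (v - u) ≤ D u - D v := by
      intro u v hxu huv hvz
      exact hL₀ (n + 1) hn u v (lt_of_le_of_lt hx hxu) huv (lt_of_lt_of_le hvz hz)
    exact ups_slope_gap_of_deriv_gap hxy hyz hcont hder hsat
  -- pass to the limit and conclude
  refine strictConcaveOn_of_slope_strict_anti_adjacent (convex_Icc 0 (R ^ 2)) ?_
  intro x y z hx hz hxy hyz
  have hy : y ∈ Set.Icc (0 : ℝ) (R ^ 2) := ⟨hx.1.trans hxy.le, hyz.le.trans hz.2⟩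
  have hyx : 0 < y - x := by linarith
  have hzy : 0 < z - y := by linarith
  -- the slope gap as a linear combination of the three values
  have key : c * (z - x) / 2 ≤
      (-(1 / (y - x))) * q μ (Real.sqrt x) + (1 / (y - x) + 1 / (z - y)) * q μ (Real.sqrt y) +
        (-(1 / (z - y))) * q μ (Real.sqrt z) := by
    refine ups_lin3_ge_of_limits (hlim x hx) (hlim y hy) (hlim z hz) ⟨L₀, fun n hn => ?_⟩
    have h := hgap n (by omega) x y z hx.1 hxy hyz hz.2
    have e : (ψ n y - ψ n x) / (y - x) - (ψ n z - ψ n y) / (z - y) =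
        (-(1 / (y - x))) * ψ n x + (1 / (y - x) + 1 / (z - y)) * ψ n y + (-(1 / (z - y))) * ψ n z := by
      field_simp; ring
    linarith [h, e.le, e.ge]
  have e2 : (-(1 / (y - x))) * q μ (Real.sqrt x) + (1 / (y - x) + 1 / (z - y)) * q μ (Real.sqrt y) +
        (-(1 / (z - y))) * q μ (Real.sqrt z) =
      (q μ (Real.sqrt y) - q μ (Real.sqrt x)) / (y - x) - (q μ (Real.sqrt z) - q μ (Real.sqrt y)) / (z - y) := by
    field_simp; ring
  have hpos : 0 < c * (z - x) / 2 := by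
    have : 0 < z - x := by linarith
    positivity
  linarith [key, e2.le, e2.ge]

/-- **SAT ⟹ UNIQ′ (`stub_sourcedColdUniq`, registered signature verbatim)**: pairing saturation of the cold
sourced torus, uniformly in large `L`, implies uniqueness of the optimal source modulus of every pointwise
thermodynamic limit. [folklore composition] -/
theorem ups_stub_sourcedColdUniq_of_pairingSaturation :
    (∀ (μ₁ μ₂ : ℝ), -4 < μ₁ → μ₁ < μ₂ → μ₂ < 0 → ∃ a₁ : ℝ, 0 < a₁ ∧ ∀ a ∈ Set.Ioc (0 : ℝ) a₁,
      ∃ K' U₀ : ℝ, 0 < K' ∧ 0 < U₀ ∧ ∀ U ∈ Set.Ioc (0 : ℝ) U₀, ∀ g ∈ Set.Icc (K' * U) (1 / 10),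
        ∀ μ ∈ Set.Ioo μ₁ μ₂, ∃ c : ℝ, 0 < c ∧ ∃ L₀ : ℕ, ∀ (L : ℕ) [NeZero L], L₀ ≤ L →
          ∀ s s' : ℝ, 0 < s → s < s' → s' < (13 * g + 1) ^ 2 →
            c * (s' - s) ≤
              (Matrix.gibbsState (Real.exp (a / U)) (dWaveSourceTorus L U μ (Real.sqrt s))
                    (pairField dWaveFormFactor L + (pairField dWaveFormFactor L)ᴴ)).re /
                  (2 * Real.sqrt s * (L : ℝ) ^ 2) -
                (Matrix.gibbsState (Real.exp (a / U)) (dWaveSourceTorus L U μ (Real.sqrt s'))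
                    (pairField dWaveFormFactor L + (pairField dWaveFormFactor L)ᴴ)).re /
                  (2 * Real.sqrt s' * (L : ℝ) ^ 2)) →
    ∀ (μ₁ μ₂ : ℝ), -4 < μ₁ → μ₁ < μ₂ → μ₂ < 0 → ∃ a₁ : ℝ, 0 < a₁ ∧ ∀ a ∈ Set.Ioc (0 : ℝ) a₁,
      ∃ K' U₀ : ℝ, 0 < K' ∧ 0 < U₀ ∧ ∀ U ∈ Set.Ioc (0 : ℝ) U₀, ∀ g ∈ Set.Icc (K' * U) (1 / 10),
        ∀ q : ℝ → ℝ → ℝ,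
          (∀ μ ∈ Set.Icc μ₁ μ₂, ∀ h ∈ Set.Icc (-(13 * g + 1)) (13 * g + 1), ∀ κ : ℝ, 0 < κ →
            ∃ L₀ : ℕ, ∀ (L : ℕ) [NeZero L], L₀ ≤ L →
              |Real.log (Matrix.partitionFn (Real.exp (a / U)) (dWaveSourceTorus L U μ h)).re /
                  (Real.exp (a / U) * (L : ℝ) ^ 2) - q μ h| ≤ κ) →
          ∀ μ ∈ Set.Ioo μ₁ μ₂, ∃ hstar : ℝ, ∀ h ∈ Set.Icc (-(13 * g + 1)) (13 * g + 1),
            q μ h - h ^ 2 / g =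
                sSup ((fun h' : ℝ => q μ h' - h' ^ 2 / g) '' Set.Icc (-(13 * g + 1)) (13 * g + 1)) →
              h = hstar ∨ h = -hstar := fun hS =>
  usc_stub_sourcedColdUniq_of_strictConcavity (ups_strictConcavity_of_pairingSaturation hS)

end

end Summit.HubbardSuperconductivity.HubbardSuperconductivity.Theorems
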